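import Summits.ValiantsHypothesis.ValiantsHypothesis.Theorems.DivisionGapPerDivisionHardWalkDefs
import Summits.ValiantsHypothesis.ValiantsHypothesis.Theorems.DivisionGapPerDivisionHardStubWalkTwin
import Summits.ValiantsHypothesis.ValiantsHypothesis.Theorems.DivisionGapPerDivisionHardStubLureCutsOut

/-!
# Crux `DivisionGap.PerDivisionHard` (stmt-ValiantsHypothesis-5065), line `pair-descent-jss-endpoint` —
stub `stub_magnetRigid`, part 1/4: the price of a closed walk and the pair-counting toolkit

The MAGNET (`Theorems/DivisionGapPerDivisionHardStubMagnetRigid.lean`) prices the cells off a placed face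
so that the price functional `U(mo) = Σ_e u e · mo e` has a unique minimiser on the support of the closed
walk sum `closedWalkSum n L R₀ ρ₀ a₀`.  This file supplies the two model-independent ingredients.

* (★) `magnet_pairing_walkExponent`: for a closed column list (`cols L = cols 0`),
  `⟨u, walkExponent⟩ + 3·RowRew + 3·ColRew = L·(3A + 3P) + Cost` with `RowRew = Σ_t u(rows t, a₀)` (the
  dropped defaults of the visited rows), `ColRew = Σ_t u(ρ₀, cols (t+1))` (the dropped complements of the
  visited columns; `Σ_t u(ρ₀, cols t) = Σ_t u(ρ₀, cols (t+1))` by `sum_closed_shift`),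
  `Cost = Σ_t (u(rows t, cols t) + 2u(rows t, cols (t+1)))` (the visit cells), `A = Σ_R u(R,a₀)`,
  `P = Σ_C u(ρ₀,C)`: the pairing `⟨u, ·⟩` is additive and the `univ.erase` sums of `walkStep` are full sums
  minus one term (`magnet_pairing_walkStep`).
* Counting along pairs of consecutive positions of an `ℕ`-indexed list: the interleaved splitting
  `Σ_{t<2H} f t = Σ_{j<H} (f (2j) + f (2j+1))` (`magnet_sum_range_two_mul`), "a value occupies at most one
  entry of a pair of different entries, and exactly one of each pair if it occupies `H` of `H` pairs"
  (`magnet_pair_count`), the alternation pattern forced by two such values (`magnet_alt_pattern`), and the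
  passage from `Fin L`-indexed to `range L`-indexed sums (`magnet_fin_sum_eq_range`).
-/

noncomputable section

-- `Summit.ValiantsHypothesis.ValiantsHypothesis.…` is the tree's mandated single-conjunct layout
-- (Sub = Summit), so the duplicated namespace component is intended.
set_option linter.dupNamespace false

namespace Summit.ValiantsHypothesis.ValiantsHypothesis.Theorems.DivisionGapPerDivisionHard

open scoped BigOperators

/-! ### The price functional `⟨u, ·⟩` is additive -/

/-- The pairing `⟨u, f⟩ = Σ_e u e · f e` of a price vector with an exponent vector is additive in the
exponent vector. [folklore] -/
theorem magnet_pairing_add {α : Type*} [Fintype α] (u : α → ℕ) (f g : α →₀ ℕ) :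
    ∑ e, u e * (f + g) e = ∑ e, u e * f e + ∑ e, u e * g e := by
  simp only [Finsupp.add_apply, mul_add, Finset.sum_add_distrib]

/-- The pairing `⟨u, ·⟩` commutes with finite sums of exponent vectors. [folklore] -/
theorem magnet_pairing_sum {α ι : Type*} [Fintype α] (u : α → ℕ) (s : Finset ι) (f : ι → α →₀ ℕ) :
    ∑ e, u e * (∑ i ∈ s, f i) e = ∑ i ∈ s, ∑ e, u e * f i e := by
  simp only [Finsupp.finsetSum_apply, Finset.mul_sum]
  exact Finset.sum_comm

/-- The pairing of `u` with a multiple `c • e_p` of a unit vector is `c · u p`. [folklore] -/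
theorem magnet_pairing_single {α : Type*} [Fintype α] [DecidableEq α] (u : α → ℕ) (p : α) (c : ℕ) :
    ∑ e, u e * (Finsupp.single p c) e = c * u p := by
  rw [Finset.sum_eq_single p (fun b _ hb => by rw [Finsupp.single_eq_of_ne hb, mul_zero])
    (fun h => absurd (Finset.mem_univ p) h), Finsupp.single_eq_same, mul_comm]

/-- The price of one walk step, in additive form: `⟨u, walkStep R Cᵢ Cₒ⟩ + 3u(R,a₀) + u(ρ₀,Cᵢ) + 2u(ρ₀,Cₒ)
= u(R,Cᵢ) + 2u(R,Cₒ) + 3A + 3P` with `A = Σ_R' u(R',a₀)` and `P = Σ_C u(ρ₀,C)` (the sums over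
`univ.erase x` are the full sums minus the `x` term). [folklore] -/
theorem magnet_pairing_walkStep {n : ℕ} (u : Fin n × Fin n → ℕ) (ρ₀ a₀ R Ci Co : Fin n) :
    ∑ e, u e * walkStep ρ₀ a₀ R Ci Co e + 3 * u (R, a₀) + u (ρ₀, Ci) + 2 * u (ρ₀, Co) =
      u (R, Ci) + 2 * u (R, Co) + 3 * ∑ R', u (R', a₀) + 3 * ∑ C, u (ρ₀, C) := by
  classical
  have h1 : ∑ R' ∈ Finset.univ.erase R, u (R', a₀) + u (R, a₀) = ∑ R', u (R', a₀) :=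
    Finset.sum_erase_add _ (fun R' => u (R', a₀)) (Finset.mem_univ R)
  have h2 : ∑ C ∈ Finset.univ.erase Ci, u (ρ₀, C) + u (ρ₀, Ci) = ∑ C, u (ρ₀, C) :=
    Finset.sum_erase_add _ (fun C => u (ρ₀, C)) (Finset.mem_univ Ci)
  have h3 : ∑ C ∈ Finset.univ.erase Co, u (ρ₀, C) + u (ρ₀, Co) = ∑ C, u (ρ₀, C) :=
    Finset.sum_erase_add _ (fun C => u (ρ₀, C)) (Finset.mem_univ Co)
  unfold walkStep
  rw [magnet_pairing_add, magnet_pairing_add, magnet_pairing_add, magnet_pairing_add,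
    magnet_pairing_single, magnet_pairing_single, magnet_pairing_sum, magnet_pairing_sum,
    magnet_pairing_sum]
  simp only [magnet_pairing_single, ← Finset.mul_sum]
  omega

/-- **The price of a closed walk (★).**  For a closed column list (`cols L = cols 0`),
`⟨u, walkExponent⟩ + 3·RowRew + 3·ColRew = L·(3A + 3P) + Cost`, where `RowRew = Σ_t u(rows t, a₀)`
(defaults of visited rows are dropped), `ColRew = Σ_t u(ρ₀, cols (t+1))` (complements of visited columns are
dropped; `Σ_t u(ρ₀, cols t) = Σ_t u(ρ₀, cols (t+1))` by closedness, `sum_closed_shift`) and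
`Cost = Σ_t (u(rows t, cols t) + 2u(rows t, cols (t+1)))` (the visit cells). [folklore] -/
theorem magnet_pairing_walkExponent {n L : ℕ} (u : Fin n × Fin n → ℕ) (ρ₀ a₀ : Fin n)
    (rows : Fin L → Fin n) (cols : Fin (L + 1) → Fin n) (hclosed : cols (Fin.last L) = cols 0) :
    ∑ e, u e * walkExponent ρ₀ a₀ rows cols e + 3 * ∑ t, u (rows t, a₀) +
        3 * ∑ t : Fin L, u (ρ₀, cols t.succ) =
      L * (3 * ∑ R', u (R', a₀) + 3 * ∑ C, u (ρ₀, C)) +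
        ∑ t : Fin L, (u (rows t, cols t.castSucc) + 2 * u (rows t, cols t.succ)) := by
  have hshift : ∑ t : Fin L, u (ρ₀, cols t.castSucc) = ∑ t : Fin L, u (ρ₀, cols t.succ) :=
    sum_closed_shift cols hclosed (fun c => u (ρ₀, c))
  have hsum := Finset.sum_congr (s₁ := (Finset.univ : Finset (Fin L))) rfl
    (fun t _ => magnet_pairing_walkStep u ρ₀ a₀ (rows t) (cols t.castSucc) (cols t.succ))
  simp only [Finset.sum_add_distrib, ← Finset.mul_sum, Finset.sum_const, Finset.card_univ,
    Fintype.card_fin, smul_eq_mul] at hsum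
  unfold walkExponent
  rw [magnet_pairing_sum, Finset.sum_add_distrib, ← Finset.mul_sum]
  rw [hshift] at hsum
  -- `hsum : Σ⟨u,step⟩ + 3 RowRew + ColRew + 2 ColRew = Σ(cell costs) + 3 (L * A) + 3 (L * P)`
  linarith [hsum]

/-! ### Counting along pairs of consecutive positions -/

/-- Interleaved splitting of a sum over `range (2H)` into `H` pairs of consecutive positions.
[folklore] -/
theorem magnet_sum_range_two_mul {M : Type*} [AddCommMonoid M] (f : ℕ → M) (H : ℕ) :
    ∑ t ∈ Finset.range (2 * H), f t = ∑ j ∈ Finset.range H, (f (2 * j) + f (2 * j + 1)) := by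
  induction H with
  | zero => simp
  | succ H ih =>
    rw [show 2 * (H + 1) = 2 * H + 1 + 1 by ring, Finset.sum_range_succ, Finset.sum_range_succ, ih,
      Finset.sum_range_succ, add_assoc]

/-- In a pair of DIFFERENT entries at most one equals `a`, so `H` such pairs contain at most `H`
entries equal to `a`; and if they contain exactly `H`, every pair contains exactly one. [folklore] -/
theorem magnet_pair_count {α : Type*} [DecidableEq α] (g g' : ℕ → α) (a : α) (H : ℕ)
    (hadj : ∀ j, j < H → g j ≠ g' j) :
    ∑ j ∈ Finset.range H, ((if g j = a then 1 else 0) + (if g' j = a then 1 else 0)) ≤ H ∧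
    (∑ j ∈ Finset.range H, ((if g j = a then 1 else 0) + (if g' j = a then 1 else 0)) = H →
      ∀ j, j < H → (if g j = a then 1 else 0) + (if g' j = a then 1 else 0) = 1) := by
  have hle : ∀ j ∈ Finset.range H,
      (if g j = a then 1 else 0) + (if g' j = a then 1 else 0) ≤ 1 := by
    intro j hj
    have hne := hadj j (Finset.mem_range.1 hj)
    by_cases h1 : g j = a
    · rw [if_pos h1, if_neg (fun h2 => hne (h1.trans h2.symm))]
    · rw [if_neg h1]
      split_ifs <;> omega
  have hH : ∑ _j ∈ Finset.range H, (1 : ℕ) = H := by simp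
  refine ⟨(Finset.sum_le_sum hle).trans hH.le, fun heq j hj => ?_⟩
  exact (Finset.sum_eq_sum_iff_of_le hle).1 (heq.trans hH.symm) j (Finset.mem_range.2 hj)

/-- Alternation along a list `c 1, c 2, …, c (2H)` with no two consecutive entries equal: if every pair
`(c (2j+1), c (2j+2))` contains exactly one `P` and exactly one `Q ≠ P`, and `c 1 = P`, then
`c (2j+1) = P` and `c (2j+2) = Q` throughout. [folklore] -/
theorem magnet_alt_pattern {α : Type*} [DecidableEq α] (c : ℕ → α) (P Q : α) (hPQ : P ≠ Q) (H : ℕ)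
    (hcc : ∀ s, s < 2 * H → c s ≠ c (s + 1))
    (hP : ∀ j, j < H →
      (if c (2 * j + 1) = P then 1 else 0) + (if c (2 * j + 1 + 1) = P then 1 else 0) = 1)
    (hQ : ∀ j, j < H →
      (if c (2 * j + 1) = Q then 1 else 0) + (if c (2 * j + 1 + 1) = Q then 1 else 0) = 1)
    (h1 : c 1 = P) : ∀ j, j < H → c (2 * j + 1) = P ∧ c (2 * j + 1 + 1) = Q := by
  -- in a pair whose first entry is `P`, the `Q` is the second entry
  have step : ∀ j, j < H → c (2 * j + 1) = P → c (2 * j + 1 + 1) = Q := by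
    intro j hj hPj
    have hq := hQ j hj
    rw [if_neg (fun h => hPQ (hPj.symm.trans h)), zero_add] at hq
    by_contra h
    rw [if_neg h] at hq
    omega
  intro j
  induction j with
  | zero =>
    intro hj
    have h1' : c (2 * 0 + 1) = P := by simpa using h1
    exact ⟨h1', step 0 hj h1'⟩
  | succ j ih =>
    intro hj
    have hQj := (ih (by omega)).2
    -- the next entry differs from `Q`, so the pair `j+1` has its `Q` second and its `P` first
    have hneQ : c (2 * (j + 1) + 1) ≠ Q := by
      rw [show 2 * (j + 1) + 1 = 2 * j + 1 + 1 + 1 by ring]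
      exact fun h => hcc (2 * j + 1 + 1) (by omega) (hQj.trans h.symm)
    have hq := hQ (j + 1) hj
    rw [if_neg hneQ, zero_add] at hq
    have hQ' : c (2 * (j + 1) + 1 + 1) = Q := by
      by_contra h
      rw [if_neg h] at hq
      omega
    have hp := hP (j + 1) hj
    have hneP : c (2 * (j + 1) + 1 + 1) ≠ P := fun h => hPQ (h.symm.trans hQ')
    rw [if_neg hneP, add_zero] at hp
    have hP' : c (2 * (j + 1) + 1) = P := by
      by_contra h
      rw [if_neg h] at hp
      omega
    exact ⟨hP', hQ'⟩

/-! ### Assembly -/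

/-- A `Fin L`-indexed sum as a `range L` sum of an `ℕ`-indexed extension. [folklore] -/
theorem magnet_fin_sum_eq_range {M : Type*} [AddCommMonoid M] {L : ℕ} (F : Fin L → M) (G : ℕ → M)
    (h : ∀ t : Fin L, F t = G t.val) : ∑ t, F t = ∑ t ∈ Finset.range L, G t := by
  rw [← Fin.sum_univ_eq_sum_range]
  exact Finset.sum_congr rfl fun t _ => h t

end Summit.ValiantsHypothesis.ValiantsHypothesis.Theorems.DivisionGapPerDivisionHard

end


/-!
# Crux `DivisionGap.PerDivisionHard` (stmt-ValiantsHypothesis-5065), line `pair-descent-jss-endpoint` —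
stub `stub_magnetRigid`, part 2/4: the magnet cells and the magnet prices

For the MAGNET (`Theorems/DivisionGapPerDivisionHardStubMagnetRigid.lean`) on a placed block graph
`placedBlock eR eC` (`G(b,k) ⊕ M₀` with `m` padding vertices, `Theorems/DivisionGapDefs.lean`):

* `magnet_mem_face_padRow` / `magnet_mem_face_padCol`: a padding row (column) `eR (pad t)` (`eC (pad t)`)
  meets the face only in its matching cell `(eR (pad t), eC (pad t))` (`lure_blockAdj_pad_iff` and its column
  version `magnet_blockAdj_pad_col`).
* `magnet_choices`: if `m ≥ 8` there are four distinct padding indices `sa, sb, t₁, t₂` whose padding column is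
  `≠ a₀` and whose padding row is `∉ {R₀, ρ₀}` (each of the three conditions excludes at most one index, by
  injectivity of `eR`, `eC`).  The magnet columns are `C_a = eC (pad sa)`, `C_b = eC (pad sb)` and the magnet
  rows `R₁ = eR (pad t₁)`, `R₂ = eR (pad t₂)`; the ten cells the rigidity argument prices are then off the face.
* `magnet_prices`: the price vector — `0` on the face, the tower `M1, M2, M3, M4` on
  `(R₁,a₀), (R₂,a₀), (ρ₀,C_a), (ρ₀,C_b)`, `2` on `(R₁,C_b)`, `1` elsewhere — and the fourteen facts about it
  that the key claim (`magnet_key`, part 3/4) consumes.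
-/

noncomputable section

-- `Summit.ValiantsHypothesis.ValiantsHypothesis.…` is the tree's mandated single-conjunct layout
-- (Sub = Summit), so the duplicated namespace component is intended.
set_option linter.dupNamespace false

namespace Summit.ValiantsHypothesis.ValiantsHypothesis.Theorems.DivisionGapPerDivisionHard

/-! ### Face facts for padding rows and columns, and the choice of the magnet cells -/

/-- A row label adjacent to the padding COLUMN label `pad t = Sum.inr (Sum.inr t)` is `pad t` itself
(the column version of `lure_blockAdj_pad_iff`). [folklore] -/
theorem magnet_blockAdj_pad_col {b k m : ℕ} (r : BlockV b k m) (t : Fin m) :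
    blockAdj b k m r (Sum.inr (Sum.inr t)) = true ↔ r = Sum.inr (Sum.inr t) := by
  rcases r with i | ⟨i, j, s⟩ | t'
  · simp [blockAdj]
  · simp [blockAdj]
  · simp [blockAdj]

/-- The face cells in the padding row `eR (pad t)` are exactly the matching cell
`(eR (pad t), eC (pad t))`. [folklore] -/
theorem magnet_mem_face_padRow {b k m n : ℕ} (eR eC : BlockV b k m ≃ Fin n) (t : Fin m)
    (C : Fin n) :
    (eR (Sum.inr (Sum.inr t)), C) ∈ placedBlock eR eC ↔ C = eC (Sum.inr (Sum.inr t)) := by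
  simp only [placedBlock, Finset.mem_filter, Finset.mem_univ, true_and, Equiv.symm_apply_apply]
  rw [lure_blockAdj_pad_iff, Equiv.symm_apply_eq]

/-- The face cells in the padding column `eC (pad t)` are exactly the matching cell
`(eR (pad t), eC (pad t))`. [folklore] -/
theorem magnet_mem_face_padCol {b k m n : ℕ} (eR eC : BlockV b k m ≃ Fin n) (t : Fin m)
    (R : Fin n) :
    (R, eC (Sum.inr (Sum.inr t))) ∈ placedBlock eR eC ↔ R = eR (Sum.inr (Sum.inr t)) := by
  simp only [placedBlock, Finset.mem_filter, Finset.mem_univ, true_and, Equiv.symm_apply_apply]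
  rw [magnet_blockAdj_pad_col, Equiv.symm_apply_eq]

/-- **Choice of the magnet indices.**  With `m ≥ 8` padding vertices there are four distinct padding
indices `sa, sb, t₁, t₂` whose padding column is not `a₀` and whose padding row is neither `R₀` nor
`ρ₀`: at most three indices are excluded (one per condition, by injectivity of `eR`, `eC`). [folklore] -/
theorem magnet_choices {b k m n : ℕ} (eR eC : BlockV b k m ≃ Fin n) (R₀ ρ₀ a₀ : Fin n)
    (hm : 8 ≤ m) :
    ∃ sa sb t₁ t₂ : Fin m, sa ≠ sb ∧ t₁ ≠ sa ∧ t₁ ≠ sb ∧ t₂ ≠ sa ∧ t₂ ≠ sb ∧ t₂ ≠ t₁ ∧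
      ∀ s, (s = sa ∨ s = sb ∨ s = t₁ ∨ s = t₂) →
        eC (Sum.inr (Sum.inr s)) ≠ a₀ ∧ eR (Sum.inr (Sum.inr s)) ≠ R₀ ∧
          eR (Sum.inr (Sum.inr s)) ≠ ρ₀ := by
  classical
  have hinj : ∀ s s' : Fin m, (Sum.inr (Sum.inr s) : BlockV b k m) = Sum.inr (Sum.inr s') →
      s = s' := fun s s' h => by simpa using h
  -- at most three bad indices
  have hbad : (Finset.univ.filter (fun s : Fin m => eC (Sum.inr (Sum.inr s)) = a₀ ∨
      (eR (Sum.inr (Sum.inr s)) = R₀ ∨ eR (Sum.inr (Sum.inr s)) = ρ₀))).card ≤ 3 := by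
    rw [Finset.filter_or, Finset.filter_or]
    have c1 : (Finset.univ.filter (fun s : Fin m => eC (Sum.inr (Sum.inr s)) = a₀)).card ≤ 1 :=
      Finset.card_le_one.2 fun x hx y hy => hinj x y (eC.injective
        ((Finset.mem_filter.1 hx).2.trans (Finset.mem_filter.1 hy).2.symm))
    have c2 : (Finset.univ.filter (fun s : Fin m => eR (Sum.inr (Sum.inr s)) = R₀)).card ≤ 1 :=
      Finset.card_le_one.2 fun x hx y hy => hinj x y (eR.injective
        ((Finset.mem_filter.1 hx).2.trans (Finset.mem_filter.1 hy).2.symm))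
    have c3 : (Finset.univ.filter (fun s : Fin m => eR (Sum.inr (Sum.inr s)) = ρ₀)).card ≤ 1 :=
      Finset.card_le_one.2 fun x hx y hy => hinj x y (eR.injective
        ((Finset.mem_filter.1 hx).2.trans (Finset.mem_filter.1 hy).2.symm))
    have u1 := Finset.card_union_le
      (Finset.univ.filter (fun s : Fin m => eR (Sum.inr (Sum.inr s)) = R₀))
      (Finset.univ.filter (fun s : Fin m => eR (Sum.inr (Sum.inr s)) = ρ₀))
    have u2 := Finset.card_union_le
      (Finset.univ.filter (fun s : Fin m => eC (Sum.inr (Sum.inr s)) = a₀))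
      (Finset.univ.filter (fun s : Fin m => eR (Sum.inr (Sum.inr s)) = R₀) ∪
        Finset.univ.filter (fun s : Fin m => eR (Sum.inr (Sum.inr s)) = ρ₀))
    omega
  -- hence at least five good ones
  have hsplit := Finset.card_filter_add_card_filter_not (s := (Finset.univ : Finset (Fin m)))
    (fun s : Fin m => eC (Sum.inr (Sum.inr s)) = a₀ ∨
      (eR (Sum.inr (Sum.inr s)) = R₀ ∨ eR (Sum.inr (Sum.inr s)) = ρ₀))
  rw [Finset.card_univ, Fintype.card_fin] at hsplit
  set good := Finset.univ.filter (fun s : Fin m => ¬ (eC (Sum.inr (Sum.inr s)) = a₀ ∨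
      (eR (Sum.inr (Sum.inr s)) = R₀ ∨ eR (Sum.inr (Sum.inr s)) = ρ₀))) with hgood
  have hG : ∀ s ∈ good, eC (Sum.inr (Sum.inr s)) ≠ a₀ ∧ eR (Sum.inr (Sum.inr s)) ≠ R₀ ∧
      eR (Sum.inr (Sum.inr s)) ≠ ρ₀ := by
    intro s hs
    have h := (Finset.mem_filter.1 hs).2
    simp only [not_or] at h
    exact h
  have hcard : 5 ≤ good.card := by omega
  obtain ⟨sa, hsa⟩ := Finset.card_pos.1 (by omega : 0 < good.card)
  have e1 := Finset.card_erase_of_mem hsa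
  obtain ⟨sb, hsb⟩ := Finset.card_pos.1 (by omega : 0 < (good.erase sa).card)
  have e2 := Finset.card_erase_of_mem hsb
  obtain ⟨t₁, ht₁⟩ := Finset.card_pos.1 (by omega : 0 < ((good.erase sa).erase sb).card)
  have e3 := Finset.card_erase_of_mem ht₁
  obtain ⟨t₂, ht₂⟩ := Finset.card_pos.1
    (by omega : 0 < (((good.erase sa).erase sb).erase t₁).card)
  simp only [Finset.mem_erase] at hsb ht₁ ht₂
  refine ⟨sa, sb, t₁, t₂, fun h => hsb.1 h.symm, ht₁.2.1, ht₁.1, ht₂.2.2.1, ht₂.2.1, ht₂.1, ?_⟩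
  rintro s (rfl | rfl | rfl | rfl)
  exacts [hG _ hsa, hG _ hsb.2, hG _ ht₁.2.2, hG _ ht₂.2.2.2]

/-- **The magnet prices.**  Given the seven distinguished rows/columns with their distinctness and the ten
off-face cells, the price vector `u` — `0` on the face, the tower `M1, M2, M3, M4` on the four magnet cells
`(R₁,a₀), (R₂,a₀), (ρ₀,C_a), (ρ₀,C_b)`, `2` on `(R₁,C_b)` and `1` on every other cell — has all the values
the rigidity argument uses. [folklore] -/
theorem magnet_prices {α : Type*} [DecidableEq α] (face : Finset (α × α))
    (R₀ R₁ R₂ ρ₀ a₀ Ca Cb : α) (M1 M2 M3 M4 : ℕ) (hM1 : 1 ≤ M1) (hM2 : 1 ≤ M2) (hM3 : 1 ≤ M3)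
    (hM4 : 1 ≤ M4) (h01 : R₀ ≠ R₁) (h02 : R₀ ≠ R₂) (h12 : R₁ ≠ R₂) (h0ρ : R₀ ≠ ρ₀)
    (h1ρ : R₁ ≠ ρ₀) (h2ρ : R₂ ≠ ρ₀) (hab : Ca ≠ Cb) (haa : Ca ≠ a₀) (hba : Cb ≠ a₀)
    (f1 : (R₁, a₀) ∉ face) (f2 : (R₂, a₀) ∉ face) (f3 : (ρ₀, Ca) ∉ face) (f4 : (ρ₀, Cb) ∉ face)
    (f5 : (R₀, Ca) ∉ face) (f6 : (R₀, Cb) ∉ face) (f7 : (R₁, Ca) ∉ face) (f8 : (R₁, Cb) ∉ face)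
    (f9 : (R₂, Ca) ∉ face) (f10 : (R₂, Cb) ∉ face) :
    ∃ u : α × α → ℕ, (∀ e ∈ face, u e = 0) ∧ (∀ e ∉ face, 1 ≤ u e) ∧
      u (R₁, a₀) = M1 ∧ u (R₂, a₀) = M2 ∧ (∀ R, R ≠ R₁ → R ≠ R₂ → u (R, a₀) ≤ 1) ∧
      u (ρ₀, Ca) = M3 ∧ u (ρ₀, Cb) = M4 ∧ (∀ C, C ≠ Ca → C ≠ Cb → u (ρ₀, C) ≤ 1) ∧
      u (R₀, Ca) = 1 ∧ u (R₀, Cb) = 1 ∧ u (R₁, Ca) = 1 ∧ u (R₁, Cb) = 2 ∧ u (R₂, Ca) = 1 ∧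
      u (R₂, Cb) = 1 := by
  have ne1 : ∀ {a c : α} (b d : α), a ≠ c → (a, b) ≠ (c, d) :=
    fun b d h h' => h (Prod.ext_iff.1 h').1
  have ne2 : ∀ {b d : α} (a c : α), b ≠ d → (a, b) ≠ (c, d) :=
    fun a c h h' => h (Prod.ext_iff.1 h').2
  refine ⟨fun e => if e ∈ face then 0 else if e = (R₁, a₀) then M1 else if e = (R₂, a₀) then M2
      else if e = (ρ₀, Ca) then M3 else if e = (ρ₀, Cb) then M4 else if e = (R₁, Cb) then 2 else 1,
    ?_, ?_, ?_, ?_, ?_, ?_, ?_, ?_, ?_, ?_, ?_, ?_, ?_, ?_⟩ <;> beta_reduce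
  · intro e he
    simp only [if_pos he]
  · intro e he
    simp only [if_neg he]
    split_ifs <;> omega
  · rw [if_neg f1, if_pos rfl]
  · rw [if_neg f2, if_neg (ne1 a₀ a₀ h12.symm), if_pos rfl]
  · intro R hR1 hR2
    by_cases hf : (R, a₀) ∈ face
    · simp only [if_pos hf]; exact Nat.zero_le _
    · simp only [if_neg hf, if_neg (ne1 a₀ a₀ hR1), if_neg (ne1 a₀ a₀ hR2),
        if_neg (ne2 R ρ₀ haa.symm), if_neg (ne2 R ρ₀ hba.symm), if_neg (ne2 R R₁ hba.symm)]
      exact le_rfl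
  · rw [if_neg f3, if_neg (ne1 Ca a₀ h1ρ.symm), if_neg (ne1 Ca a₀ h2ρ.symm), if_pos rfl]
  · rw [if_neg f4, if_neg (ne1 Cb a₀ h1ρ.symm), if_neg (ne1 Cb a₀ h2ρ.symm),
      if_neg (ne2 ρ₀ ρ₀ hab.symm), if_pos rfl]
  · intro C hCa hCb
    by_cases hf : (ρ₀, C) ∈ face
    · simp only [if_pos hf]; exact Nat.zero_le _
    · simp only [if_neg hf, if_neg (ne1 C a₀ h1ρ.symm), if_neg (ne1 C a₀ h2ρ.symm),
        if_neg (ne2 ρ₀ ρ₀ hCa), if_neg (ne2 ρ₀ ρ₀ hCb), if_neg (ne1 C Cb h1ρ.symm)]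
      exact le_rfl
  · simp only [if_neg f5, if_neg (ne1 Ca a₀ h01), if_neg (ne1 Ca a₀ h02), if_neg (ne1 Ca Ca h0ρ),
      if_neg (ne1 Ca Cb h0ρ), if_neg (ne1 Ca Cb h01)]
  · simp only [if_neg f6, if_neg (ne1 Cb a₀ h01), if_neg (ne1 Cb a₀ h02), if_neg (ne1 Cb Ca h0ρ),
      if_neg (ne1 Cb Cb h0ρ), if_neg (ne1 Cb Cb h01)]
  · simp only [if_neg f7, if_neg (ne2 R₁ R₁ haa), if_neg (ne2 R₁ R₂ haa), if_neg (ne1 Ca Ca h1ρ),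
      if_neg (ne1 Ca Cb h1ρ), if_neg (ne2 R₁ R₁ hab)]
  · rw [if_neg f8, if_neg (ne2 R₁ R₁ hba), if_neg (ne2 R₁ R₂ hba), if_neg (ne1 Cb Ca h1ρ),
      if_neg (ne1 Cb Cb h1ρ), if_pos rfl]
  · simp only [if_neg f9, if_neg (ne2 R₂ R₁ haa), if_neg (ne2 R₂ R₂ haa), if_neg (ne1 Ca Ca h2ρ),
      if_neg (ne1 Ca Cb h2ρ), if_neg (ne1 Ca Cb h12.symm)]
  · simp only [if_neg f10, if_neg (ne2 R₂ R₁ hba), if_neg (ne2 R₂ R₂ hba), if_neg (ne1 Cb Ca h2ρ),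
      if_neg (ne1 Cb Cb h2ρ), if_neg (ne1 Cb Cb h12.symm)]


/-- ∀-form of `magnet_mem_face_padRow` (registered marker `stub_magnetFacePad` of the line's skeleton, so that this
helper file lands attached to the crux): the face cells of a padding row are exactly its matching cell. [folklore] -/
theorem stub_magnetFacePad :
    ∀ (b k m n : ℕ) (eR eC : BlockV b k m ≃ Fin n) (t : Fin m) (C : Fin n),
      (eR (Sum.inr (Sum.inr t)), C) ∈ placedBlock eR eC ↔ C = eC (Sum.inr (Sum.inr t)) :=
  fun _ _ _ _ eR eC t C => magnet_mem_face_padRow eR eC t C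

end Summit.ValiantsHypothesis.ValiantsHypothesis.Theorems.DivisionGapPerDivisionHard

end
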